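import Summits.FinalStateConjecture.FinalStateConjecture.Theorems.ClusterCompletenessOmegaLimitMultiKerrBirkhoffRecurrence
import Summits.FinalStateConjecture.FinalStateConjecture.Theorems.ClusterCompletenessOmegaLimitMultiKerrOmegaLimitSetCompact
import Summits.FinalStateConjecture.FinalStateConjecture.Theorems.ClusterCompletenessOmegaLimitMultiKerrOmegaLimitSetClosed
import Summits.FinalStateConjecture.FinalStateConjecture.Theorems.ClusterCompletenessOmegaLimitMultiKerrTranslates
import Mathlib.Analysis.Normed.Group.Tannery
import HarnessLib

/-!
# Route ClusterCompleteness · crux `OmegaLimitMultiKerr` — uniformly recurrent dark limits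
# (Birkhoff recurrence in the `Cᵏ_loc`-translate currency)

Structure lemma for the crux stmt-FinalStateConjecture-14664 (`ClusterCompleteness.OmegaLimitMultiKerr`),
line `Sketch`, lead gen 6 (registered main theorem `exists_omegaLimit_uniformlyRecurrent`, closed form).

Setting (the currency every era chart instantiates, `…Translates` / `…HoleOmegaLimits` /
`…StarHoleDictionary`): a field `h : E → W` of class `C^{k+1}` on an open domain `O` invariant
under the Killing translation `x ↦ x + s • e`, TAME along `e` (on every compact `K ⊆ O` the
derivatives of order `≤ k + 1` of `h` are bounded at all late translates `z + t • e`, `t ≥ a`). Its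
`Cᵏ_loc` ω-LIMITS are the `Cᵏ` fields `g` on `O` with `supCkENorm K k (h (· + Tₙ • e) − g) → 0` on
every compact along some `Tₙ → +∞` — the "dark limits" of the development read in the era chart.

**Theorem (`exists_omegaLimit_uniformlyRecurrent`).** Some ω-limit `g` of `h` is UNIFORMLY
RECURRENT (Birkhoff almost periodic) under the translation: for every compact `K ⊆ O` and `ε > 0`
there is `L > 0` such that every time interval `[t, t + L]`, `t ∈ ℝ`, contains an `s` with
`supCkENorm K k (g (· + s • e) − g) < ε`.

Proof. The ω-limit set, read through the graphs of its members over `O`, is made a pseudometric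
space with `dist g g' = ∑ⱼ 2⁻ʲ min (1, ‖g − g'‖_{Cᵏ(Kx j)})` along a compact exhaustion `Kx` of `O`;
convergence in this distance is exactly `Cᵏ_loc` convergence on `O`
(`tendsto_tsum_geometric_toReal_min` / `tendsto_of_tendsto_tsum_geometric_toReal_min`), so the
space is COMPACT (sequential compactness of the ω-limit set under tameness,
`exists_omegaLimit_subseq_of_omegaLimits`, gen 5) and the translations act on it as a FLOW by
continuous maps (invariance `exists_omegaLimit_translate`, gen 5; `supCkENorm_comp_add_right`,
gen 3). Birkhoff's recurrence theorem (`exists_almostPeriodic`, `…BirkhoffRecurrence`: minimal sets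
by Zorn + Cantor, almost periodicity of their points) gives the almost-periodic member.

Reading for the crux (gen 5 isolated a physical TRANSFER INEQUALITY (P1) as the input making dark
limits stationary): the dark limits of a tame non-settling development may be taken UNIFORMLY
RECURRENT IN ERA GAUGE, so (P1) can be replaced by the rigidity statement (P1′) "a tame anchored
almost-periodic eternal vacuum end is stationary" — the almost-periodic extension of the published
time-periodic ⇒ stationary theorems (Bičák–Scholtz–Tod 2010; Alexakis–Schlue 2018). Sources:
Birkhoff, *Dynamical Systems* (1927), Ch. VII §§1–2; Hale 1980, Ch. I §8. Everything is proved;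
Mathlib + landed `Theorems` files only, no definitions.
-/

-- every `Summit.FinalStateConjecture.FinalStateConjecture.…` name repeats the summit = sub-problem segment (D-0017 layout)
set_option linter.dupNamespace false

noncomputable section

open Set Filter Topology Function
open scoped ContDiff Topology ENNReal

namespace Summit.FinalStateConjecture.FinalStateConjecture.Theorems.ClusterCompleteness

open Literature.Geometry.Lorentzian

/-! ### The weighted series of truncated seminorms -/

/-- `min 1 (a + b) ≤ min 1 a + min 1 b` in `ℝ≥0∞` (truncation is subadditive). [folklore] -/
private theorem min_one_add_le (a b : ℝ≥0∞) : min 1 (a + b) ≤ min 1 a + min 1 b := by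
  rcases le_total 1 a with ha | ha
  · exact (min_le_left _ _).trans (by rw [min_eq_left ha]; exact le_self_add)
  rcases le_total 1 b with hb | hb
  · exact (min_le_left _ _).trans (by rw [min_eq_left hb]; exact le_add_self)
  rw [min_eq_right ha, min_eq_right hb]
  exact min_le_right _ _

/-- The terms `2⁻ʲ · (min 1 X).toReal` of the distance series are dominated by the geometric
series, hence summable. [folklore] -/
private theorem summable_geometric_toReal_min (a : ℕ → ℝ≥0∞) :
    Summable fun j ↦ (1 / 2 : ℝ) ^ j * (min 1 (a j)).toReal := by
  refine Summable.of_nonneg_of_le (fun j ↦ by positivity) (fun j ↦ ?_)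
    (summable_geometric_of_lt_one (by norm_num) one_half_lt_one)
  have h1 : (min 1 (a j)).toReal ≤ 1 := by
    have := ENNReal.toReal_mono ENNReal.one_ne_top (min_le_left (1 : ℝ≥0∞) (a j))
    rwa [ENNReal.toReal_one] at this
  calc (1 / 2 : ℝ) ^ j * (min 1 (a j)).toReal ≤ (1 / 2 : ℝ) ^ j * 1 :=
        mul_le_mul_of_nonneg_left h1 (by positivity)
    _ = (1 / 2 : ℝ) ^ j := mul_one _

/-- **Termwise convergence to zero gives convergence of the distance series** (Tannery's
theorem with the geometric majorant). [folklore] -/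
theorem tendsto_tsum_geometric_toReal_min {α : Type*} {l : Filter α} {a : α → ℕ → ℝ≥0∞}
    (h : ∀ j, Tendsto (fun n ↦ a n j) l (𝓝 0)) :
    Tendsto (fun n ↦ ∑' j, (1 / 2 : ℝ) ^ j * (min 1 (a n j)).toReal) l (𝓝 0) := by
  have hlim : ∀ j, Tendsto (fun n ↦ (1 / 2 : ℝ) ^ j * (min 1 (a n j)).toReal) l (𝓝 0) := by
    intro j
    have h1 : Tendsto (fun n ↦ min 1 (a n j)) l (𝓝 0) := by
      have := (tendsto_const_nhds (x := (1 : ℝ≥0∞))).min (h j)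
      rwa [min_eq_right zero_le_one] at this
    have h2 : Tendsto (fun n ↦ (min 1 (a n j)).toReal) l (𝓝 0) := by
      have := (ENNReal.tendsto_toReal ENNReal.zero_ne_top).comp h1
      rwa [ENNReal.toReal_zero] at this
    simpa only [mul_zero] using h2.const_mul ((1 / 2 : ℝ) ^ j)
  have hb : ∀ᶠ n in l, ∀ j, ‖(1 / 2 : ℝ) ^ j * (min 1 (a n j)).toReal‖ ≤ (1 / 2 : ℝ) ^ j := by
    refine Eventually.of_forall fun n j ↦ ?_
    have h1 : (min 1 (a n j)).toReal ≤ 1 := by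
      have := ENNReal.toReal_mono ENNReal.one_ne_top (min_le_left (1 : ℝ≥0∞) (a n j))
      rwa [ENNReal.toReal_one] at this
    rw [Real.norm_eq_abs, abs_of_nonneg (by positivity)]
    calc (1 / 2 : ℝ) ^ j * (min 1 (a n j)).toReal ≤ (1 / 2 : ℝ) ^ j * 1 :=
          mul_le_mul_of_nonneg_left h1 (by positivity)
      _ = (1 / 2 : ℝ) ^ j := mul_one _
  have := tendsto_tsum_of_dominated_convergence
    (summable_geometric_of_lt_one (by norm_num) one_half_lt_one) hlim hb
  simpa only [tsum_zero] using this

/-- **Convergence of the distance series gives termwise convergence to zero**: each term is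
dominated by the (nonnegative) series, and `min 1 X → 0` forces `X → 0`. [folklore] -/
theorem tendsto_of_tendsto_tsum_geometric_toReal_min {α : Type*} {l : Filter α}
    {a : α → ℕ → ℝ≥0∞}
    (h : Tendsto (fun n ↦ ∑' j, (1 / 2 : ℝ) ^ j * (min 1 (a n j)).toReal) l (𝓝 0)) (j : ℕ) :
    Tendsto (fun n ↦ a n j) l (𝓝 0) := by
  -- the `j`-th term tends to zero
  have hterm : Tendsto (fun n ↦ (1 / 2 : ℝ) ^ j * (min 1 (a n j)).toReal) l (𝓝 0) := by
    refine squeeze_zero (fun n ↦ by positivity) (fun n ↦ ?_) h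
    exact (summable_geometric_toReal_min (a n)).le_tsum j fun i _ ↦ by positivity
  have hmin : Tendsto (fun n ↦ (min 1 (a n j)).toReal) l (𝓝 0) := by
    have := hterm.const_mul (2 ^ j : ℝ)
    simp only [mul_zero, ← mul_assoc] at this
    refine this.congr fun n ↦ ?_
    rw [show (2 : ℝ) ^ j * (1 / 2) ^ j = 1 by rw [← mul_pow]; norm_num, one_mul]
  have hmin' : Tendsto (fun n ↦ min 1 (a n j)) l (𝓝 0) := by
    refine (ENNReal.tendsto_toReal_iff (fun n ↦ ?_) ENNReal.zero_ne_top).1 ?_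
    · exact ne_top_of_le_ne_top ENNReal.one_ne_top (min_le_left _ _)
    · rwa [ENNReal.toReal_zero]
  refine ENNReal.tendsto_nhds_zero.2 fun ε hε ↦ ?_
  have hε' : (0 : ℝ≥0∞) < min ε 2⁻¹ := lt_min hε (by norm_num)
  filter_upwards [ENNReal.tendsto_nhds_zero.1 hmin' _ hε'] with n hn
  have hlt : min 1 (a n j) < 1 :=
    (hn.trans (min_le_right _ _)).trans_lt (by norm_num)
  have heq : min 1 (a n j) = a n j := min_eq_right (le_of_lt (by simpa using hlt))
  rw [← heq]
  exact hn.trans (min_le_left _ _)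

section Setting

variable {E : Type*} [NormedAddCommGroup E] [NormedSpace ℝ E]
  {W : Type*} [NormedAddCommGroup W] [NormedSpace ℝ W]

/-- Swapping the two terms of a difference does not change its `Cᵏ` sup norm. [folklore] -/
private theorem supCkENorm_sub_comm'' (S : Set E) (k : ℕ) (f g : E → W) :
    supCkENorm S k (fun x ↦ f x - g x) = supCkENorm S k (fun x ↦ g x - f x) := by
  have hfg : (fun x ↦ f x - g x) = -fun x ↦ g x - f x := by
    funext x
    simp only [Pi.neg_apply, neg_sub]
  simp only [supCkENorm, hfg, iteratedFDeriv_neg_apply, enorm_neg]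

/-- **Triangle inequality for the truncated seminorms**: for `f, g, u` of class `Cᵏ` at every
point of `S`, `min 1 ‖f − u‖_{Cᵏ(S)} ≤ min 1 ‖f − g‖_{Cᵏ(S)} + min 1 ‖g − u‖_{Cᵏ(S)}`, in real
form after `toReal`. [folklore] -/
private theorem toReal_min_supCkENorm_sub_le {S : Set E} {k : ℕ} {f g u : E → W}
    (hf : ∀ x ∈ S, ContDiffAt ℝ k f x) (hg : ∀ x ∈ S, ContDiffAt ℝ k g x)
    (hu : ∀ x ∈ S, ContDiffAt ℝ k u x) :
    (min 1 (supCkENorm S k (fun x ↦ f x - u x))).toReal ≤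
      (min 1 (supCkENorm S k (fun x ↦ f x - g x))).toReal +
        (min 1 (supCkENorm S k (fun x ↦ g x - u x))).toReal := by
  have hsplit : (fun x ↦ f x - u x) = (fun x ↦ f x - g x) + fun x ↦ g x - u x := by
    funext x
    simp only [Pi.add_apply, sub_add_sub_cancel]
  have h1 : supCkENorm S k (fun x ↦ f x - u x) ≤
      supCkENorm S k (fun x ↦ f x - g x) + supCkENorm S k (fun x ↦ g x - u x) := by
    rw [hsplit]
    exact supCkENorm_add_le (fun x hx ↦ (hf x hx).sub (hg x hx))
      (fun x hx ↦ (hg x hx).sub (hu x hx))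
  have h2 := (min_le_min_left (1 : ℝ≥0∞) h1).trans (min_one_add_le _ _)
  have hne : ∀ X : ℝ≥0∞, min 1 X ≠ ⊤ := fun X ↦
    ne_top_of_le_ne_top ENNReal.one_ne_top (min_le_left _ _)
  rw [← ENNReal.toReal_add (hne _) (hne _)]
  exact ENNReal.toReal_mono (ENNReal.add_ne_top.2 ⟨hne _, hne _⟩) h2

/-- **Triangle inequality for the distance series** along a family of sets `Kx j` on which
`f, g, u` are `Cᵏ` at every point. [folklore] -/
private theorem tsum_dist_triangle (Kx : ℕ → Set E) {k : ℕ} {f g u : E → W}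
    (hf : ∀ j, ∀ x ∈ Kx j, ContDiffAt ℝ k f x) (hg : ∀ j, ∀ x ∈ Kx j, ContDiffAt ℝ k g x)
    (hu : ∀ j, ∀ x ∈ Kx j, ContDiffAt ℝ k u x) :
    ∑' j, (1 / 2 : ℝ) ^ j * (min 1 (supCkENorm (Kx j) k (fun x ↦ f x - u x))).toReal ≤
      ∑' j, (1 / 2 : ℝ) ^ j * (min 1 (supCkENorm (Kx j) k (fun x ↦ f x - g x))).toReal +
        ∑' j, (1 / 2 : ℝ) ^ j * (min 1 (supCkENorm (Kx j) k (fun x ↦ g x - u x))).toReal := by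
  rw [← (summable_geometric_toReal_min _).tsum_add (summable_geometric_toReal_min _)]
  refine (summable_geometric_toReal_min _).tsum_le_tsum (fun j ↦ ?_)
    ((summable_geometric_toReal_min _).add (summable_geometric_toReal_min _))
  rw [← mul_add]
  exact mul_le_mul_of_nonneg_left (toReal_min_supCkENorm_sub_le (hf j) (hg j) (hu j))
    (by positivity)

/-- **`Cᵏ_loc` convergence along an exhaustion is `Cᵏ_loc` convergence**: if every compact subset
of `O` lies in some `Kx j`, convergence of the `Cᵏ` sup norms on every `Kx j` gives it on every
compact subset of `O`. [folklore] -/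
private theorem tendsto_supCkENorm_of_exhaustion {α : Type*} {l : Filter α} {O : Set E}
    (Kx : ℕ → Set E) (hcov : ∀ K ⊆ O, IsCompact K → ∃ j, K ⊆ Kx j) {k : ℕ} {u : α → E → W}
    (h : ∀ j, Tendsto (fun n ↦ supCkENorm (Kx j) k (u n)) l (𝓝 0)) :
    ∀ K ⊆ O, IsCompact K → Tendsto (fun n ↦ supCkENorm K k (u n)) l (𝓝 0) := by
  intro K hKO hK
  obtain ⟨j, hj⟩ := hcov K hKO hK
  exact tendsto_of_tendsto_of_tendsto_of_le_of_le' tendsto_const_nhds (h j)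
    (Eventually.of_forall fun _ ↦ zero_le) (Eventually.of_forall fun n ↦ supCkENorm_mono hj k _)

end Setting

/-- **Registered structure stub (crux stmt-FinalStateConjecture-14664, line `Sketch`, stub
`UniformRecurrence`): some dark limit is uniformly recurrent.** Let `O ⊆ E` be open and invariant
under the translations `x ↦ x + s • e`, `h : E → W` of class `C^{k+1}` on `O` and TAME along `e`
(on every compact `K ⊆ O` the derivatives of order `≤ k + 1` of `h` are bounded at all translates
`z + t • e`, `z ∈ K`, `t ≥ a`). Then `h` has a `Cᵏ_loc` ω-limit `g` — a `Cᵏ` field on `O` with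
`supCkENorm K k (h (· + Tₙ • e) − g) → 0` on every compact `K ⊆ O` along some `Tₙ → +∞` — which
is UNIFORMLY RECURRENT (Birkhoff almost periodic) under the translation: for every compact `K ⊆ O`
and every `ε > 0` there is `L > 0` such that every interval `[t, t + L]`, `t ∈ ℝ`, contains an
`s` with `supCkENorm K k (g (· + s • e) − g) < ε`. Birkhoff's recurrence theorem
(`exists_almostPeriodic`) applied to the ω-limit set made a compact pseudometric space through the
graphs of its members over `O` (distance `∑ⱼ 2⁻ʲ min (1, ‖· − ·‖_{Cᵏ(Kx j)})` along a compact
exhaustion; compactness = `exists_omegaLimit_subseq_of_omegaLimits`, flow = translation,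
invariance = `exists_omegaLimit_translate`). Birkhoff 1927, Ch. VII §§1–2; Hale 1980, Ch. I §8.
Closed form. [cite: Hale1980, Ch. I §8 Thm. 8.1] -/
theorem exists_omegaLimit_uniformlyRecurrent :
    ∀ {E : Type*} [NormedAddCommGroup E] [NormedSpace ℝ E] [FiniteDimensional ℝ E]
      {W : Type*} [NormedAddCommGroup W] [NormedSpace ℝ W] [FiniteDimensional ℝ W]
      {O : Set E} {e : E}, IsOpen O → (∀ x ∈ O, ∀ s : ℝ, x + s • e ∈ O) →
      ∀ {k : ℕ} {h : E → W}, ContDiffOn ℝ (k + 1) h O →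
      (∀ K ⊆ O, IsCompact K → ∃ Λ a : ℝ, ∀ t : ℝ, a ≤ t → ∀ i, i ≤ k + 1 → ∀ z ∈ K,
        ‖iteratedFDeriv ℝ i h (z + t • e)‖ ≤ Λ) →
      ∃ g : E → W, ContDiffOn ℝ k g O ∧
        (∃ T : ℕ → ℝ, Tendsto T atTop atTop ∧ ∀ K ⊆ O, IsCompact K →
          Tendsto (fun n ↦ supCkENorm K k (fun x ↦ h (x + T n • e) - g x)) atTop (𝓝 0)) ∧
        ∀ K ⊆ O, IsCompact K → ∀ ε : ℝ, 0 < ε → ∃ L : ℝ, 0 < L ∧ ∀ t : ℝ,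
          ∃ s ∈ Icc t (t + L),
            supCkENorm K k (fun x ↦ g (x + s • e) - g x) < ENNReal.ofReal ε := by
  intro E _ _ _ W _ _ _ O e hO hOe k h hh htame
  classical
  -- (0) a compact exhaustion of `O`
  obtain ⟨Kx, hKc, hKO, hcov⟩ := exists_isCompact_subset_nat_of_isOpen (E := E) hO
  -- (1) the ω-limit predicate and the graph carrier
  let P : (E → W) → Prop := fun g ↦ ContDiffOn ℝ k g O ∧ ∃ T : ℕ → ℝ, Tendsto T atTop atTop ∧
    ∀ K ⊆ O, IsCompact K →
      Tendsto (fun n ↦ supCkENorm K k (fun x ↦ h (x + T n • e) - g x)) atTop (𝓝 0)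
  let gr : (E → W) → Set (E × W) := fun g ↦ {p | p.1 ∈ O ∧ p.2 = g p.1}
  have hgr : ∀ {g g' : E → W}, gr g = gr g' → ∀ x ∈ O, g x = g' x := by
    intro g g' hgg' x hx
    have : (x, g x) ∈ gr g' := hgg' ▸ ⟨hx, rfl⟩
    exact this.2
  let Ω : Type _ := {G : Set (E × W) // ∃ g, P g ∧ gr g = G}
  have hrep : ∀ G : Ω, ∃ g, P g ∧ gr g = G.1 := fun G ↦ G.2
  choose rep hrepP hrepgr using hrep
  -- the representative of the class of `g` agrees with `g` on `O`
  have hrep_mk : ∀ (g : E → W) (hg : P g), ∀ x ∈ O, rep ⟨gr g, g, hg, rfl⟩ x = g x :=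
    fun g hg ↦ hgr (hrepgr ⟨gr g, g, hg, rfl⟩)
  -- germ agreement on `O` transfers `Cᵏ` sup norms over subsets of `O`
  have hcongr : ∀ {f f' u : E → W}, (∀ x ∈ O, f x = f' x) → ∀ K ⊆ O,
      supCkENorm K k (fun x ↦ u x - f x) = supCkENorm K k (fun x ↦ u x - f' x) := by
    intro f f' u hff' K hKO'
    refine supCkENorm_congr fun x hx ↦ ?_
    filter_upwards [hO.mem_nhds (hKO' hx)] with y hy
    rw [hff' y hy]
  have hcongr' : ∀ {f f' u : E → W}, (∀ x ∈ O, f x = f' x) → ∀ K ⊆ O,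
      supCkENorm K k (fun x ↦ f x - u x) = supCkENorm K k (fun x ↦ f' x - u x) := by
    intro f f' u hff' K hKO'
    rw [supCkENorm_sub_comm'' K k f, supCkENorm_sub_comm'' K k f', hcongr hff' K hKO']
  -- representatives are `Cᵏ` at the points of every `Kx j`
  have hrepC : ∀ (G : Ω) (j : ℕ), ∀ x ∈ Kx j, ContDiffAt ℝ k (rep G) x := fun G j x hx ↦
    (hrepP G).1.contDiffAt (hO.mem_nhds (hKO j hx))
  -- (2) the distance
  let ρ : (E → W) → (E → W) → ℝ := fun f g ↦
    ∑' j, (1 / 2 : ℝ) ^ j * (min 1 (supCkENorm (Kx j) k (fun x ↦ f x - g x))).toReal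
  letI inst : PseudoMetricSpace Ω :=
    { dist := fun G G' ↦ ρ (rep G) (rep G')
      dist_self := fun G ↦ by
        show ρ (rep G) (rep G) = 0
        have h0 : ∀ j, (1 / 2 : ℝ) ^ j *
            (min 1 (supCkENorm (Kx j) k (fun x ↦ rep G x - rep G x))).toReal = 0 := by
          intro j
          have h1 : supCkENorm (Kx j) k (fun x ↦ rep G x - rep G x) = 0 := by
            simp only [sub_self]
            exact supCkENorm_zero (Kx j) k
          rw [h1, min_eq_right zero_le_one, ENNReal.toReal_zero, mul_zero]
        show ∑' j, (1 / 2 : ℝ) ^ j *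
            (min 1 (supCkENorm (Kx j) k (fun x ↦ rep G x - rep G x))).toReal = 0
        simp only [h0, tsum_zero]
      dist_comm := fun G G' ↦ by
        show ρ (rep G) (rep G') = ρ (rep G') (rep G)
        simp only [ρ, supCkENorm_sub_comm'' _ k (rep G) (rep G')]
      dist_triangle := fun G G' G'' ↦ by
        show ρ (rep G) (rep G'') ≤ ρ (rep G) (rep G') + ρ (rep G') (rep G'')
        exact tsum_dist_triangle Kx (hrepC G) (hrepC G') (hrepC G'') }
  have hdist : ∀ G G' : Ω, dist G G' = ρ (rep G) (rep G') := fun _ _ ↦ rfl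
  -- (3) convergence in `Ω` is `Cᵏ_loc` convergence of representatives on `O`
  have hconv : ∀ {u : ℕ → Ω} {G : Ω}, Tendsto u atTop (𝓝 G) ↔ ∀ K ⊆ O, IsCompact K →
      Tendsto (fun n ↦ supCkENorm K k (fun x ↦ rep (u n) x - rep G x)) atTop (𝓝 0) := by
    intro u G
    rw [tendsto_iff_dist_tendsto_zero]
    simp only [hdist]
    constructor
    · intro h
      exact tendsto_supCkENorm_of_exhaustion Kx hcov
        (u := fun n x ↦ rep (u n) x - rep G x)
        (tendsto_of_tendsto_tsum_geometric_toReal_min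
          (a := fun n j ↦ supCkENorm (Kx j) k (fun x ↦ rep (u n) x - rep G x)) h)
    · intro h
      exact tendsto_tsum_geometric_toReal_min
        (a := fun n j ↦ supCkENorm (Kx j) k (fun x ↦ rep (u n) x - rep G x))
        fun j ↦ h (Kx j) (hKO j) (hKc j)
  -- (4) `Ω` is nonempty (ω-limits exist along `Tₙ = n`) and (5) compact (gen 5's sequential compactness)
  have hOe' : ∀ x ∈ O, ∀ s : ℝ, 0 ≤ s → x + s • e ∈ O := fun x hx s _ ↦ hOe x hx s
  have hbndT : ∀ {T : ℕ → ℝ}, Tendsto T atTop atTop → ∀ K ⊆ O, IsCompact K → ∃ Λ : ℝ,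
      ∀ᶠ n in atTop, ∀ i, i ≤ k + 1 → ∀ z ∈ K, ‖iteratedFDeriv ℝ i h (z + T n • e)‖ ≤ Λ := by
    intro T hT K hKO' hK
    obtain ⟨Λ, a, hΛ⟩ := htame K hKO' hK
    exact ⟨Λ, (hT.eventually_ge_atTop a).mono fun n hn ↦ hΛ (T n) hn⟩
  haveI hne : Nonempty Ω := by
    obtain ⟨g, φ, hφ, hg, hlim⟩ := exists_strictMono_tendsto_supCkENorm_translate_sub hO hOe' hh
      (T := fun n : ℕ ↦ (n : ℝ)) (fun n ↦ Nat.cast_nonneg n)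
      (hbndT tendsto_natCast_atTop_atTop)
    exact ⟨⟨gr g, g, ⟨hg, fun n ↦ ((φ n : ℕ) : ℝ),
      tendsto_natCast_atTop_atTop.comp hφ.tendsto_atTop, hlim⟩, rfl⟩⟩
  haveI hcpt : CompactSpace Ω := by
    refine ⟨isCompact_iff_isSeqCompact.2 fun u _ ↦ ?_⟩
    obtain ⟨g, φ, hφ, hg, hω, hlim⟩ := exists_omegaLimit_subseq_of_omegaLimits hO hOe Kx hKc hKO
      hcov hh htame (gs := fun m ↦ rep (u m)) (fun m ↦ (hrepP (u m)).1) fun m ↦ (hrepP (u m)).2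
    have hPg : P g := ⟨hg, hω⟩
    refine ⟨⟨gr g, g, hPg, rfl⟩, mem_univ _, φ, hφ, hconv.2 fun K hKO' hK ↦ ?_⟩
    simpa only [comp_apply, hcongr (hrep_mk g hPg) K hKO'] using hlim K hKO' hK
  -- (6) the translation flow on `Ω`
  have hPtr : ∀ (G : Ω) (s : ℝ), P fun x ↦ rep G (x + s • e) := by
    intro G s
    obtain ⟨T, hT, hlim⟩ := (hrepP G).2
    exact ⟨contDiffOn_comp_add_smul_of_forall_mem hOe (hrepP G).1 s,
      exists_omegaLimit_translate hOe hT hlim s⟩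
  let Φ : ℝ → Ω → Ω := fun s G ↦ ⟨gr fun x ↦ rep G (x + s • e), _, hPtr G s, rfl⟩
  have hΦrep : ∀ (s : ℝ) (G : Ω), ∀ x ∈ O, rep (Φ s G) x = rep G (x + s • e) :=
    fun s G ↦ hrep_mk _ (hPtr G s)
  have hΦadd : ∀ s t G, Φ (s + t) G = Φ s (Φ t G) := by
    intro s t G
    apply Subtype.ext
    show gr (fun x ↦ rep G (x + (s + t) • e)) = gr fun x ↦ rep (Φ t G) (x + s • e)
    ext p
    simp only [gr, mem_setOf_eq]
    constructor
    · rintro ⟨hp, hpe⟩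
      refine ⟨hp, ?_⟩
      rw [hΦrep t G _ (hOe _ hp s), hpe, add_assoc, ← add_smul]
    · rintro ⟨hp, hpe⟩
      refine ⟨hp, ?_⟩
      rw [hpe, hΦrep t G _ (hOe _ hp s), add_assoc, ← add_smul]
  -- continuity of each `Φ s` (sequential continuity suffices)
  have hΦcont : ∀ s, Continuous (Φ s) := by
    intro s
    refine continuous_iff_seqContinuous.2 fun u G hu ↦ hconv.2 fun K hKO' hK ↦ ?_
    have hKs : (fun x ↦ x + s • e) '' K ⊆ O := by
      rintro _ ⟨x, hx, rfl⟩
      exact hOe x (hKO' hx) s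
    have hKsc : IsCompact ((fun x ↦ x + s • e) '' K) := hK.image (continuous_id.add continuous_const)
    have hlim := hconv.1 hu _ hKs hKsc
    refine hlim.congr fun n ↦ ?_
    rw [← supCkENorm_comp_add_right K k (fun x ↦ rep (u n) x - rep G x) (s • e)]
    show supCkENorm K k (fun x ↦ rep (u n) (x + s • e) - rep G (x + s • e)) =
      supCkENorm K k (fun x ↦ rep ((Φ s ∘ u) n) x - rep (Φ s G) x)
    rw [hcongr (f' := fun x ↦ rep (Φ s G) x) (fun x hx ↦ (hΦrep s G x hx).symm) K hKO',
      hcongr' (f' := fun x ↦ rep (Φ s (u n)) x) (fun x hx ↦ (hΦrep s (u n) x hx).symm) K hKO']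
    rfl
  -- (7) Birkhoff's recurrence theorem on `Ω`
  obtain ⟨G₀, hG₀⟩ := exists_almostPeriodic Φ hΦcont hΦadd
  refine ⟨rep G₀, (hrepP G₀).1, (hrepP G₀).2, fun K hKO' hK ε hε ↦ ?_⟩
  obtain ⟨j, hj⟩ := hcov K hKO' hK
  have hε' : 0 < (1 / 2 : ℝ) ^ j * min 1 ε := by positivity
  obtain ⟨L, hL, hret⟩ := hG₀ _ hε'
  refine ⟨L, hL, fun t ↦ ?_⟩
  obtain ⟨s, hs, hds⟩ := hret t
  refine ⟨s, hs, ?_⟩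
  set X : ℝ≥0∞ := supCkENorm (Kx j) k (fun x ↦ rep G₀ (x + s • e) - rep G₀ x) with hX
  have hterm : (1 / 2 : ℝ) ^ j * (min 1 X).toReal < (1 / 2 : ℝ) ^ j * min 1 ε := by
    rw [hdist] at hds
    have hle : (1 / 2 : ℝ) ^ j * (min 1 (supCkENorm (Kx j) k
        (fun x ↦ rep (Φ s G₀) x - rep G₀ x))).toReal ≤ ρ (rep (Φ s G₀)) (rep G₀) :=
      (summable_geometric_toReal_min fun i ↦ supCkENorm (Kx i) k
        (fun x ↦ rep (Φ s G₀) x - rep G₀ x)).le_tsum j fun i _ ↦ by positivity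
    rw [hcongr' (f' := fun x ↦ rep G₀ (x + s • e)) (hΦrep s G₀) (Kx j) (hKO j)] at hle
    exact hle.trans_lt hds
  have hmin : (min 1 X).toReal < min 1 ε := lt_of_mul_lt_mul_left hterm (by positivity)
  have hXlt1 : min 1 X < 1 := by
    have h1 : (min 1 X).toReal < 1 := hmin.trans_le (min_le_left _ _)
    by_contra hcon
    rw [not_lt] at hcon
    have : min 1 X = 1 := le_antisymm (min_le_left _ _) hcon
    rw [this, ENNReal.toReal_one] at h1
    exact lt_irrefl _ h1
  have hXeq : min 1 X = X := min_eq_right (le_of_lt (by simpa using hXlt1))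
  have hXne : X ≠ ⊤ := by
    rw [← hXeq]
    exact ne_top_of_lt hXlt1
  have hXε : X < ENNReal.ofReal ε := by
    rw [← ENNReal.ofReal_toReal hXne]
    refine (ENNReal.ofReal_lt_ofReal_iff hε).2 ?_
    have := hmin.trans_le (min_le_right _ _)
    rwa [hXeq] at this
  exact (supCkENorm_mono hj k _).trans_lt hXε

end Summit.FinalStateConjecture.FinalStateConjecture.Theorems.ClusterCompleteness

end
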